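import Summits.AtomisticToContinuum.HydrodynamicLimit.Theses.StiffCollisionalRelaxation
import Summits.AtomisticToContinuum.HydrodynamicLimit.Theorems.CollisionIsometryCLTMacroClosureInBand
import HarnessLib

/-!
# `StiffCollisionalRelaxation.Assembly` (stmt-AtomisticToContinuum-18061) — PROVED

`Assembly := MesoscopicLLN → TimeZeroThermalFloor → HsEntropyUniformlyConvex → HsFreeEnergyConvex →
FastMomentRelaxation → CollisionalTransferLocality → AprioriBoundsInBand → RelEntropyStability →
SecondLawInProbability → HydrodynamicLimit` (route StiffCollisionalRelaxation, rev 6b).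

Proof: the three kinetic antecedents `FastMomentRelaxation` (stmt-9522), `CollisionalTransferLocality` and
`AprioriBoundsInBand` (stmt-17749) already give the packing-guarded conjunct by the sibling route
`CollisionIsometryCLT`'s landed UNIFORM macroscopic closure
`MacroClosureLine.Barycentric.macroClosureInBand_proof : UniformDock.MacroClosureInBand` (file
`CollisionIsometryCLTMacroClosureInBand.lean`; two-scale barycentric relative-entropy engine with its own Gronwall
bookkeeping, Clausius in mean from Liouville invariance + entropy inequality + the two-scale homogeneous block
MGF, hard-sphere thermodynamics and Ruelle convexity proved as lemmas): the two `CollisionalTransferLocality`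
decls are the same term, `StiffCollisionalRelaxation.AprioriBoundsInBand` IS `UniformDock.AprioriBoundsInBand`
(`UniformDock.aprioriBoundsInBand_iff_stiff`), and the `∀ t` hinge gives the uniform pre-shock hinge
(`UniformDock.fmrInBand_of_stiff`). The four statics antecedents and the two macroscopic ones
(`RelEntropyStability` 9520, `SecondLawInProbability` 9521) are idle.
-/

namespace Summit.AtomisticToContinuum.HydrodynamicLimit.Theorems.MacroClosureLine.StiffDock

open Summit.AtomisticToContinuum.HydrodynamicLimit.Theses
open Summit.AtomisticToContinuum.HydrodynamicLimit.Theorems.MacroClosureLine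

/-- **`StiffCollisionalRelaxation.Assembly` PROVED** (stmt-AtomisticToContinuum-18061): of its nine antecedents
only `FastMomentRelaxation`, `CollisionalTransferLocality` and `AprioriBoundsInBand` are used, through the
sibling route's landed uniform macroscopic closure `Barycentric.macroClosureInBand_proof`.
[cite: Dafermos2005, Thm 5.2.1] [cite: OllaVaradhanYau1993, §1] -/
theorem stiffAssembly_proof : StiffCollisionalRelaxation.Assembly :=
  fun _ _ _ _ hF hC hA _ _ =>
    Barycentric.macroClosureInBand_proof hC (UniformDock.aprioriBoundsInBand_iff_stiff.2 hA)
      (UniformDock.fmrInBand_of_stiff hF)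

end Summit.AtomisticToContinuum.HydrodynamicLimit.Theorems.MacroClosureLine.StiffDock
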